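/-
Copyright (c) 2026 the pub-hodgecm-mathlib formalisation cell (harness21).  Prover seat hodgecm-mathlib-K2E2-p12 (g5): Track B «K2-LIT», ENGINE E1,
h413 = stmt-HodgeConjecture-24833; (q10) «R7₃-SCALAR» FILE 3, brick (3-iii-b2) «FINITE EULER PRODUCT N=3» (FILE 3 census 2026-09-04T08:25Z, dealer K2E1-plan (g5) «=» 08:27Z ∕ 08:34Z).
-/
import Summits.HodgeConjecture.HodgeConjecture.Theorems.K2E1IntertwiningLocalMeanCMU3               -- ★ (3-iii-b1): `hf1`, `hcont`, `localMean_eq_localScalar` at every good place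
import Summits.HodgeConjecture.HodgeConjecture.Theorems.K2E1IntertwiningScalarContinuationU3        -- ★ FILE 1: `hasProd_localScalar_three_cm` (`N = 3` Euler product of the scalar, `Re σ > 2`)
import Summits.HodgeConjecture.HodgeConjecture.Theorems.AdelicProductIntegral                       -- ★ p858070: Tate 3.3.1 for integrable factorizable functions on `(𝔸_{K,f})^ι`
import HarnessLib

/-!
# K2·E1 — `K2E1IntertwiningScalarEulerProductU3Finite` ((q10) «R7₃-SCALAR» FILE 3, brick (3-iii-b2)): THE FINITE-ADELIC EULER PRODUCT OF THE `U(2,1)` INTERTWINING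
# INTEGRAND AT THE CM PAIR — `μ(𝒪̂³)⁻¹·∫_{(𝔸_{L⁺,f})³} ∏ᶠ_v Q_v(x_v)^{−σ} dμ = (∏_{v ∈ S₀} a_v(σ)) · N^{S₀}(σ) ∕ D^{S₀}(σ)` for `σ > 2`,
# `N^{S} = ζ^S(σ−1)·L^S(σ−1,ε)·L^S(2σ−2,ε)`, `D^{S} = ζ^S(σ)·L^S(σ,ε)·L^S(2σ−1,ε)`, `ε = ε_{L∕L⁺}` — Tate's Thm 3.3.1 (★ `AdelicProductIntegral`) glued to ★ FILE 1

Track B ∕ K2-LIT, crux h413 = `stmt-HodgeConjecture-24833`, route of record `HCCMUnconditional`; cell `hodgecm-mathlib`, squad K2, ENGINE E1 (campaign «EIS-RANK-ONE», R7 at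
`N = 3`).  THEOREMS ONLY (no `def`, no instance, no notation, no `sorry`; default heartbeats); lane `--supports stmt-HodgeConjecture-24833 --as helper` (count-neutral).
HYPOTHESIS-FIRST (dealer «=» 08:34Z): the global integrability `hint` of `x ↦ ∏ᶠ_v Q_v(x_v)^{−σ}` on `((𝔸_{L⁺,f})³, μ)` is a LETTER, discharged in the assembly (3-iv) from Godement
(★ `K2E1IntertwiningGrowthU3`) through ★ (ν-1) `K2E1UnipotentHaarNormalisationU3` :93 and ★ `K2E1FiniteAdeleBasisTransport`; the bad finite set `S₀` is a LETTER with
`hgood : ∀ v ∉ S₀`, `v` unramified in `L`, `|2|_v = 1`, `δ` a unit at every `w ∣ v`.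

* §1 `eq_prod_mul_of_hasProd` — bookkeeping: `HasProd a A`, `HasProd (e|_{∁S₀}) E`, `a = e` off `S₀` ⟹ `A = (∏_{S₀} a)·E` (`Finset.hasProd`, `HasProd.mul_compl`, `HasProd.unique`).
* §2 **`hasProd_localMean_three`** — ★ `AdelicProductIntegral.hasProd_localIntegral_of_integrable` at `K = L⁺`, `ι = Fin 3`, `ν_v = ν⊗ν⊗ν`, `f_v = ((Q_v^{−σ} : ℝ) : ℂ)`: the normalised
  local means `a_v(σ) = ν_v(𝒪_v³)⁻¹ ∫ Q_v^{−σ} dν_v` are multipliable with product `μ(𝒪̂³)⁻¹ ∫ ∏ᶠ_v Q_v^{−σ} dμ` (every real `σ`, given `hint`).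
* §3 **`inv_measure_smul_integral_finprod_eq_prod_mul_eulerProduct_three`** (HEAD, `σ > 2`): `μ(𝒪̂³)⁻¹·∫ ∏ᶠ_v Q_v^{−σ} dμ = (∏_{v∈S₀} a_v(σ)) · N^{S₀}(σ)∕D^{S₀}(σ)` in ★ FILE 1's
  `partialStandardL` currency at `σ ↦ (σ : ℂ)` (§1 with §2, ★ (3-iii-b1) `localMean_eq_localScalar` off `S₀`, ★ FILE 1 `hasProd_localScalar_three_cm (S := ↑S₀)`);
  `integral_finprod_eq_measure_smul_prod_mul_eulerProduct_three` (the same solved for the integral).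
HONEST LABEL: HC_CM is proved only modulo the 7 printed citations (2 remaining named inputs: hLiu418 = `stmt-HodgeConjecture-24832`, h413 = `stmt-HodgeConjecture-24833`) until rung 0
closes; this file asserts no named fact and closes no socket; count-neutral; conditional only on its displayed letters `hint`, `hgood`.

## References
* [TateThesis1967] J. Tate, *Fourier analysis in number fields and Hecke's zeta-functions* (1967): Thm 3.3.1, Lemma 3.3.2.
* [Langlands1971] R. P. Langlands, *Euler Products* (1971): §3.
* [MoeglinWaldspurger1995] C. Mœglin, J.-L. Waldspurger, *Spectral Decomposition and Eisenstein Series* (1995): II.1.7, IV.1.11.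
* [Rogawski1990] J. D. Rogawski, *Automorphic Representations of Unitary Groups in Three Variables* (1990): §4.5.
-/

set_option autoImplicit false
set_option linter.dupNamespace false -- the mandated namespace repeats `HodgeConjecture.HodgeConjecture`

noncomputable section

open MeasureTheory NumberField IsDedekindDomain Filter Topology
open scoped NNReal ENNReal
open Literature.NumberTheory.Automorphic Literature.NumberTheory.Automorphic.UnitaryGroup Literature.NumberTheory.GaloisRepresentations
open Literature.NumberTheory.GaloisRepresentations.IsNonarchimedeanLocalField Literature.NumberTheory.LFunctions
open Summit.HodgeConjecture.HodgeConjecture.Cruxes.H413.AdelicProductIntegral (hasProd_localIntegral_of_integrable)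
open Summit.HodgeConjecture.HodgeConjecture.Cruxes.H413.K2E1IntertwiningScalarContinuationU3 (hasProd_localScalar_three_cm)
open Summit.HodgeConjecture.HodgeConjecture.Cruxes.H413.K2E1IntertwiningLocalMeanCMU3

namespace Summit.HodgeConjecture.HodgeConjecture.Cruxes.H413.K2E1IntertwiningScalarEulerProductU3Finite

/-! ## §1 Bookkeeping: a `HasProd` splits as (finite part) × (Euler product off `S₀`) -/

/-- **`HasProd a A`, `HasProd e E` for `e` on `{v ∉ S₀}` and `a v = e v` off the finset `S₀` give `A = (∏_{v ∈ S₀} a v) · E`** (`Finset.hasProd`, `HasProd.mul_compl`, uniqueness of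
limits in `ℂ`). [folklore] -/
theorem eq_prod_mul_of_hasProd {β : Type} (S₀ : Finset β) {a : β → ℂ} {e : {v // v ∉ (↑S₀ : Set β)} → ℂ} {A E : ℂ} (hP : HasProd a A)
    (hE : HasProd e E) (hloc : ∀ (v : β) (hv : v ∉ S₀), a v = e ⟨v, hv⟩) : A = (∏ v ∈ S₀, a v) * E := by
  have hE' : HasProd (a ∘ (↑) : ((↑S₀ : Set β)ᶜ : Set β) → ℂ) E := by
    have heq : (a ∘ (↑) : ((↑S₀ : Set β)ᶜ : Set β) → ℂ) = e := funext fun v => hloc v.1 v.2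
    rw [heq]
    exact hE
  exact hP.unique ((S₀.hasProd a).mul_compl hE')

variable (L : Type) [Field L] [NumberField L] [IsCMField L] {δ : L} (hcδ : IsCMField.complexConj L δ = -δ) (hδ : δ ≠ 0)
  {d : ↥(maximalRealSubfield L)} (hd : δ * δ = algebraMap ↥(maximalRealSubfield L) L d)
  [MeasurableSpace (FiniteAdeleRing (𝓞 ↥(maximalRealSubfield L)) ↥(maximalRealSubfield L))] [BorelSpace (FiniteAdeleRing (𝓞 ↥(maximalRealSubfield L)) ↥(maximalRealSubfield L))]
  [∀ v : HeightOneSpectrum (𝓞 ↥(maximalRealSubfield L)), MeasurableSpace (v.adicCompletion ↥(maximalRealSubfield L))]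
  [∀ v : HeightOneSpectrum (𝓞 ↥(maximalRealSubfield L)), BorelSpace (v.adicCompletion ↥(maximalRealSubfield L))]
  (μ : Measure (Fin 3 → FiniteAdeleRing (𝓞 ↥(maximalRealSubfield L)) ↥(maximalRealSubfield L))) [μ.IsAddHaarMeasure]
  (νv : ∀ v : HeightOneSpectrum (𝓞 ↥(maximalRealSubfield L)), Measure (v.adicCompletion ↥(maximalRealSubfield L))) [∀ v, (νv v).IsAddHaarMeasure]
  (S₀ : Finset (HeightOneSpectrum (𝓞 ↥(maximalRealSubfield L))))

/-! ## §2 Tate 3.3.1 for the intertwining integrand: the local means are multipliable with product the normalised global integral -/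

include hd in
/-- **THE LOCAL MEANS OF `Q_v^{−σ}` ARE MULTIPLIABLE WITH PRODUCT `μ(𝒪̂³)⁻¹·∫ ∏ᶠ_v Q_v(x_v)^{−σ} dμ`** (★ `AdelicProductIntegral.hasProd_localIntegral_of_integrable` at `K = L⁺`, `ι = Fin 3`,
`ν_v = ν⊗ν⊗ν`, `f_v = ((Q_v^{−σ} : ℝ) : ℂ)`; `hcont` ∕ `hf1` from ★ (3-iii-b1); `hint` a letter). [cite: TateThesis1967, Thm 3.3.1] [cite: Langlands1971, §3] -/
theorem hasProd_localMean_three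
    (hgood : ∀ v ∉ S₀, Algebra.IsUnramifiedIn (𝓞 L) v.asIdeal ∧ Valued.v (2 : v.adicCompletion ↥(maximalRealSubfield L)) = 1 ∧
      ∀ w : PlacesOver L v, Valued.v (algebraMap L (LocalRing L v) δ w) = 1) (σ : ℝ)
    (hint : Integrable (fun x : Fin 3 → FiniteAdeleRing (𝓞 ↥(maximalRealSubfield L)) ↥(maximalRealSubfield L) =>
      ∏ᶠ v : HeightOneSpectrum (𝓞 ↥(maximalRealSubfield L)),
        (((∏ w' : PlacesOver L v, max 1 (max ((normAbs (w'.1.adicCompletion L) (quadraticLocalEquiv L v (IsCMField.complexConj L) hcδ hδ (x 0 v, x 1 v) w') : ℝ≥0) : ℝ)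
          ((normAbs (w'.1.adicCompletion L) ((toLocalRing L v (x 2 v) * algebraMap L (LocalRing L v) δ -
            toLocalRing L v 2⁻¹ * (quadraticLocalEquiv L v (IsCMField.complexConj L) hcδ hδ (x 0 v, x 1 v) *
              conjLocal L (IsCMField.complexConj L) v (quadraticLocalEquiv L v (IsCMField.complexConj L) hcδ hδ (x 0 v, x 1 v)))) w') : ℝ≥0) : ℝ))) ^ (-σ) : ℝ) : ℂ)) μ) :
    HasProd (fun v : HeightOneSpectrum (𝓞 ↥(maximalRealSubfield L)) =>
        ((Measure.pi fun _ : Fin 3 => νv v) (integralBox ↥(maximalRealSubfield L) (Fin 3) v)).toReal⁻¹ •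
          ∫ p : Fin 3 → v.adicCompletion ↥(maximalRealSubfield L),
            (((∏ w' : PlacesOver L v, max 1 (max ((normAbs (w'.1.adicCompletion L) (quadraticLocalEquiv L v (IsCMField.complexConj L) hcδ hδ (p 0, p 1) w') : ℝ≥0) : ℝ)
              ((normAbs (w'.1.adicCompletion L) ((toLocalRing L v (p 2) * algebraMap L (LocalRing L v) δ -
                toLocalRing L v 2⁻¹ * (quadraticLocalEquiv L v (IsCMField.complexConj L) hcδ hδ (p 0, p 1) *
                  conjLocal L (IsCMField.complexConj L) v (quadraticLocalEquiv L v (IsCMField.complexConj L) hcδ hδ (p 0, p 1)))) w') : ℝ≥0) : ℝ))) ^ (-σ) : ℝ) : ℂ)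
            ∂(Measure.pi fun _ : Fin 3 => νv v))
      ((μ (offBox (K := ↥(maximalRealSubfield L)) (ι := Fin 3) ∅)).toReal⁻¹ •
        ∫ x : Fin 3 → FiniteAdeleRing (𝓞 ↥(maximalRealSubfield L)) ↥(maximalRealSubfield L),
          ∏ᶠ v : HeightOneSpectrum (𝓞 ↥(maximalRealSubfield L)),
            (((∏ w' : PlacesOver L v, max 1 (max ((normAbs (w'.1.adicCompletion L) (quadraticLocalEquiv L v (IsCMField.complexConj L) hcδ hδ (x 0 v, x 1 v) w') : ℝ≥0) : ℝ)
              ((normAbs (w'.1.adicCompletion L) ((toLocalRing L v (x 2 v) * algebraMap L (LocalRing L v) δ -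
                toLocalRing L v 2⁻¹ * (quadraticLocalEquiv L v (IsCMField.complexConj L) hcδ hδ (x 0 v, x 1 v) *
                  conjLocal L (IsCMField.complexConj L) v (quadraticLocalEquiv L v (IsCMField.complexConj L) hcδ hδ (x 0 v, x 1 v)))) w') : ℝ≥0) : ℝ))) ^ (-σ) : ℝ) : ℂ) ∂μ) := by
  haveI : ∀ v : HeightOneSpectrum (𝓞 ↥(maximalRealSubfield L)), SecondCountableTopology (v.adicCompletion ↥(maximalRealSubfield L)) :=
    fun v => secondCountableTopology_localField _
  haveI : ∀ v : HeightOneSpectrum (𝓞 ↥(maximalRealSubfield L)), SigmaCompactSpace (v.adicCompletion ↥(maximalRealSubfield L)) :=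
    fun v => sigmaCompactSpace_of_isNonarchimedeanLocalField _
  exact hasProd_localIntegral_of_integrable ↥(maximalRealSubfield L) (Fin 3) μ (fun v => Measure.pi fun _ : Fin 3 => νv v)
    (fun v p => (((∏ w' : PlacesOver L v, max 1 (max ((normAbs (w'.1.adicCompletion L) (quadraticLocalEquiv L v (IsCMField.complexConj L) hcδ hδ (p 0, p 1) w') : ℝ≥0) : ℝ)
      ((normAbs (w'.1.adicCompletion L) ((toLocalRing L v (p 2) * algebraMap L (LocalRing L v) δ -
        toLocalRing L v 2⁻¹ * (quadraticLocalEquiv L v (IsCMField.complexConj L) hcδ hδ (p 0, p 1) *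
          conjLocal L (IsCMField.complexConj L) v (quadraticLocalEquiv L v (IsCMField.complexConj L) hcδ hδ (p 0, p 1)))) w') : ℝ≥0) : ℝ))) ^ (-σ) : ℝ) : ℂ))
    S₀ (fun v => continuous_ofReal_localHeight_rpow L hcδ hδ v σ)
    (fun v hv p hp => ofReal_localHeight_rpow_eq_one_of_mem_integralBox L hcδ hδ hd v (hgood v hv).1 (hgood v hv).2.1 (hgood v hv).2.2 σ hp) hint

/-! ## §3 HEAD: the normalised global integral is `(∏_{v∈S₀} a_v) · N^{S₀}(σ)∕D^{S₀}(σ)` -/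

include hd in
/-- **THE FINITE-ADELIC EULER PRODUCT OF THE `U(2,1)` INTERTWINING INTEGRAND AT THE CM PAIR** (`σ > 2` real; `ε = quadraticHeckeCharCM L`; `S₀ ⊇` bad places; `hint` a letter):
`μ(𝒪̂³)⁻¹ · ∫_{(𝔸_{L⁺,f})³} ∏ᶠ_v Q_v(x_v)^{−σ} dμ = (∏_{v ∈ S₀} ν_v(𝒪_v³)⁻¹ ∫ Q_v^{−σ} dν_v) · [ζ^{S₀}(σ−1) L^{S₀}(σ−1,ε) L^{S₀}(2σ−2,ε)] ∕ [ζ^{S₀}(σ) L^{S₀}(σ,ε) L^{S₀}(2σ−1,ε)]`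
in ★ FILE 1's `partialStandardL` currency at `σ ↦ (σ : ℂ)` (§2; ★ (3-iii-b1) `localMean_eq_localScalar` off `S₀`; ★ FILE 1 `hasProd_localScalar_three_cm (S := ↑S₀)`; §1).
[cite: Langlands1971, §3] [cite: MoeglinWaldspurger1995, IV.1.11] [cite: Rogawski1990, §4.5] [cite: TateThesis1967, Thm 3.3.1] -/
theorem inv_measure_smul_integral_finprod_eq_prod_mul_eulerProduct_three
    (hgood : ∀ v ∉ S₀, Algebra.IsUnramifiedIn (𝓞 L) v.asIdeal ∧ Valued.v (2 : v.adicCompletion ↥(maximalRealSubfield L)) = 1 ∧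
      ∀ w : PlacesOver L v, Valued.v (algebraMap L (LocalRing L v) δ w) = 1) {σ : ℝ} (hσ : 2 < σ)
    (hint : Integrable (fun x : Fin 3 → FiniteAdeleRing (𝓞 ↥(maximalRealSubfield L)) ↥(maximalRealSubfield L) =>
      ∏ᶠ v : HeightOneSpectrum (𝓞 ↥(maximalRealSubfield L)),
        (((∏ w' : PlacesOver L v, max 1 (max ((normAbs (w'.1.adicCompletion L) (quadraticLocalEquiv L v (IsCMField.complexConj L) hcδ hδ (x 0 v, x 1 v) w') : ℝ≥0) : ℝ)
          ((normAbs (w'.1.adicCompletion L) ((toLocalRing L v (x 2 v) * algebraMap L (LocalRing L v) δ -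
            toLocalRing L v 2⁻¹ * (quadraticLocalEquiv L v (IsCMField.complexConj L) hcδ hδ (x 0 v, x 1 v) *
              conjLocal L (IsCMField.complexConj L) v (quadraticLocalEquiv L v (IsCMField.complexConj L) hcδ hδ (x 0 v, x 1 v)))) w') : ℝ≥0) : ℝ))) ^ (-σ) : ℝ) : ℂ)) μ) :
    (μ (offBox (K := ↥(maximalRealSubfield L)) (ι := Fin 3) ∅)).toReal⁻¹ •
        ∫ x : Fin 3 → FiniteAdeleRing (𝓞 ↥(maximalRealSubfield L)) ↥(maximalRealSubfield L),
          ∏ᶠ v : HeightOneSpectrum (𝓞 ↥(maximalRealSubfield L)),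
            (((∏ w' : PlacesOver L v, max 1 (max ((normAbs (w'.1.adicCompletion L) (quadraticLocalEquiv L v (IsCMField.complexConj L) hcδ hδ (x 0 v, x 1 v) w') : ℝ≥0) : ℝ)
              ((normAbs (w'.1.adicCompletion L) ((toLocalRing L v (x 2 v) * algebraMap L (LocalRing L v) δ -
                toLocalRing L v 2⁻¹ * (quadraticLocalEquiv L v (IsCMField.complexConj L) hcδ hδ (x 0 v, x 1 v) *
                  conjLocal L (IsCMField.complexConj L) v (quadraticLocalEquiv L v (IsCMField.complexConj L) hcδ hδ (x 0 v, x 1 v)))) w') : ℝ≥0) : ℝ))) ^ (-σ) : ℝ) : ℂ) ∂μ =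
      (∏ v ∈ S₀, ((Measure.pi fun _ : Fin 3 => νv v) (integralBox ↥(maximalRealSubfield L) (Fin 3) v)).toReal⁻¹ •
          ∫ p : Fin 3 → v.adicCompletion ↥(maximalRealSubfield L),
            (((∏ w' : PlacesOver L v, max 1 (max ((normAbs (w'.1.adicCompletion L) (quadraticLocalEquiv L v (IsCMField.complexConj L) hcδ hδ (p 0, p 1) w') : ℝ≥0) : ℝ)
              ((normAbs (w'.1.adicCompletion L) ((toLocalRing L v (p 2) * algebraMap L (LocalRing L v) δ -
                toLocalRing L v 2⁻¹ * (quadraticLocalEquiv L v (IsCMField.complexConj L) hcδ hδ (p 0, p 1) *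
                  conjLocal L (IsCMField.complexConj L) v (quadraticLocalEquiv L v (IsCMField.complexConj L) hcδ hδ (p 0, p 1)))) w') : ℝ≥0) : ℝ))) ^ (-σ) : ℝ) : ℂ)
            ∂(Measure.pi fun _ : Fin 3 => νv v)) *
        ((partialStandardL (↑S₀ : Set (HeightOneSpectrum (𝓞 ↥(maximalRealSubfield L)))) (fun _ => {1}) ((σ : ℂ) - 1) *
              partialStandardL (↑S₀ : Set (HeightOneSpectrum (𝓞 ↥(maximalRealSubfield L)))) (fun v => {(quadraticHeckeCharCM L).valueAtUniformizer v}) ((σ : ℂ) - 1) *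
            partialStandardL (↑S₀ : Set (HeightOneSpectrum (𝓞 ↥(maximalRealSubfield L)))) (fun v => {(quadraticHeckeCharCM L).valueAtUniformizer v}) (2 * (σ : ℂ) - 2)) /
          (partialStandardL (↑S₀ : Set (HeightOneSpectrum (𝓞 ↥(maximalRealSubfield L)))) (fun _ => {1}) (σ : ℂ) * partialStandardL (↑S₀ : Set (HeightOneSpectrum (𝓞 ↥(maximalRealSubfield L)))) (fun v => {(quadraticHeckeCharCM L).valueAtUniformizer v}) (σ : ℂ) *
            partialStandardL (↑S₀ : Set (HeightOneSpectrum (𝓞 ↥(maximalRealSubfield L)))) (fun v => {(quadraticHeckeCharCM L).valueAtUniformizer v}) (2 * (σ : ℂ) - 1))) := by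
  have hσ' : 2 < ((σ : ℂ)).re := by rwa [Complex.ofReal_re]
  have hσ1 : 1 < σ := by linarith
  refine eq_prod_mul_of_hasProd S₀ (hasProd_localMean_three L hcδ hδ hd μ νv S₀ hgood σ hint)
    (hasProd_localScalar_three_cm L (S := (↑S₀ : Set (HeightOneSpectrum (𝓞 ↥(maximalRealSubfield L))))) hσ') (fun v hv => ?_)
  exact localMean_eq_localScalar L hcδ hδ hd v (νv v) (hgood v hv).1 (hgood v hv).2.1 (hgood v hv).2.2 hσ1

include hd in
/-- **THE SAME, SOLVED FOR THE INTEGRAL**: `∫_{(𝔸_{L⁺,f})³} ∏ᶠ_v Q_v(x_v)^{−σ} dμ = μ(𝒪̂³) · (∏_{v ∈ S₀} a_v(σ)) · N^{S₀}(σ)∕D^{S₀}(σ)` (`σ > 2`; `0 < μ(𝒪̂³) < ∞`).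
[cite: TateThesis1967, Thm 3.3.1] [cite: Langlands1971, §3] -/
theorem integral_finprod_eq_measure_mul_prod_mul_eulerProduct_three
    (hgood : ∀ v ∉ S₀, Algebra.IsUnramifiedIn (𝓞 L) v.asIdeal ∧ Valued.v (2 : v.adicCompletion ↥(maximalRealSubfield L)) = 1 ∧
      ∀ w : PlacesOver L v, Valued.v (algebraMap L (LocalRing L v) δ w) = 1) {σ : ℝ} (hσ : 2 < σ)
    (hint : Integrable (fun x : Fin 3 → FiniteAdeleRing (𝓞 ↥(maximalRealSubfield L)) ↥(maximalRealSubfield L) =>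
      ∏ᶠ v : HeightOneSpectrum (𝓞 ↥(maximalRealSubfield L)),
        (((∏ w' : PlacesOver L v, max 1 (max ((normAbs (w'.1.adicCompletion L) (quadraticLocalEquiv L v (IsCMField.complexConj L) hcδ hδ (x 0 v, x 1 v) w') : ℝ≥0) : ℝ)
          ((normAbs (w'.1.adicCompletion L) ((toLocalRing L v (x 2 v) * algebraMap L (LocalRing L v) δ -
            toLocalRing L v 2⁻¹ * (quadraticLocalEquiv L v (IsCMField.complexConj L) hcδ hδ (x 0 v, x 1 v) *
              conjLocal L (IsCMField.complexConj L) v (quadraticLocalEquiv L v (IsCMField.complexConj L) hcδ hδ (x 0 v, x 1 v)))) w') : ℝ≥0) : ℝ))) ^ (-σ) : ℝ) : ℂ)) μ) :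
    ∫ x : Fin 3 → FiniteAdeleRing (𝓞 ↥(maximalRealSubfield L)) ↥(maximalRealSubfield L),
          ∏ᶠ v : HeightOneSpectrum (𝓞 ↥(maximalRealSubfield L)),
            (((∏ w' : PlacesOver L v, max 1 (max ((normAbs (w'.1.adicCompletion L) (quadraticLocalEquiv L v (IsCMField.complexConj L) hcδ hδ (x 0 v, x 1 v) w') : ℝ≥0) : ℝ)
              ((normAbs (w'.1.adicCompletion L) ((toLocalRing L v (x 2 v) * algebraMap L (LocalRing L v) δ -
                toLocalRing L v 2⁻¹ * (quadraticLocalEquiv L v (IsCMField.complexConj L) hcδ hδ (x 0 v, x 1 v) *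
                  conjLocal L (IsCMField.complexConj L) v (quadraticLocalEquiv L v (IsCMField.complexConj L) hcδ hδ (x 0 v, x 1 v)))) w') : ℝ≥0) : ℝ))) ^ (-σ) : ℝ) : ℂ) ∂μ =
      (μ (offBox (K := ↥(maximalRealSubfield L)) (ι := Fin 3) ∅)).toReal *
        ((∏ v ∈ S₀, ((Measure.pi fun _ : Fin 3 => νv v) (integralBox ↥(maximalRealSubfield L) (Fin 3) v)).toReal⁻¹ •
            ∫ p : Fin 3 → v.adicCompletion ↥(maximalRealSubfield L),
              (((∏ w' : PlacesOver L v, max 1 (max ((normAbs (w'.1.adicCompletion L) (quadraticLocalEquiv L v (IsCMField.complexConj L) hcδ hδ (p 0, p 1) w') : ℝ≥0) : ℝ)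
                ((normAbs (w'.1.adicCompletion L) ((toLocalRing L v (p 2) * algebraMap L (LocalRing L v) δ -
                  toLocalRing L v 2⁻¹ * (quadraticLocalEquiv L v (IsCMField.complexConj L) hcδ hδ (p 0, p 1) *
                    conjLocal L (IsCMField.complexConj L) v (quadraticLocalEquiv L v (IsCMField.complexConj L) hcδ hδ (p 0, p 1)))) w') : ℝ≥0) : ℝ))) ^ (-σ) : ℝ) : ℂ)
              ∂(Measure.pi fun _ : Fin 3 => νv v)) *
          ((partialStandardL (↑S₀ : Set (HeightOneSpectrum (𝓞 ↥(maximalRealSubfield L)))) (fun _ => {1}) ((σ : ℂ) - 1) *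
                partialStandardL (↑S₀ : Set (HeightOneSpectrum (𝓞 ↥(maximalRealSubfield L)))) (fun v => {(quadraticHeckeCharCM L).valueAtUniformizer v}) ((σ : ℂ) - 1) *
              partialStandardL (↑S₀ : Set (HeightOneSpectrum (𝓞 ↥(maximalRealSubfield L)))) (fun v => {(quadraticHeckeCharCM L).valueAtUniformizer v}) (2 * (σ : ℂ) - 2)) /
            (partialStandardL (↑S₀ : Set (HeightOneSpectrum (𝓞 ↥(maximalRealSubfield L)))) (fun _ => {1}) (σ : ℂ) * partialStandardL (↑S₀ : Set (HeightOneSpectrum (𝓞 ↥(maximalRealSubfield L)))) (fun v => {(quadraticHeckeCharCM L).valueAtUniformizer v}) (σ : ℂ) *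
              partialStandardL (↑S₀ : Set (HeightOneSpectrum (𝓞 ↥(maximalRealSubfield L)))) (fun v => {(quadraticHeckeCharCM L).valueAtUniformizer v}) (2 * (σ : ℂ) - 1)))) := by
  have h := inv_measure_smul_integral_finprod_eq_prod_mul_eulerProduct_three L hcδ hδ hd μ νv S₀ hgood hσ hint
  have hc0 : (μ (offBox (K := ↥(maximalRealSubfield L)) (ι := Fin 3) ∅)).toReal ≠ 0 :=
    ENNReal.toReal_ne_zero.mpr ⟨(measure_offBox_empty_pos ↥(maximalRealSubfield L) (Fin 3) μ).ne', (measure_offBox_empty_lt_top ↥(maximalRealSubfield L) (Fin 3) μ).ne⟩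
  rw [← h, Complex.real_smul, ← mul_assoc, ← Complex.ofReal_mul, mul_inv_cancel₀ hc0, Complex.ofReal_one, one_mul]

end Summit.HodgeConjecture.HodgeConjecture.Cruxes.H413.K2E1IntertwiningScalarEulerProductU3Finite

end
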